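import Mathlib
import HarnessLib
import Summits.QuantumFields.BalabanUV.Beta.GaugeFixingCubic266
import Literature.MathematicalPhysics.QuantumFieldTheory.Balaban1983to89.B9Eq37Insertion
import Literature.MathematicalPhysics.QuantumLattice.LieTrotter

/-!
# [Balaban1987RG1] (0.14)/(0.19) p. 254–255: the exponential gauge-fixing POTENTIAL `U ↦ 1 − Re tr U` in the chart `U = e^{iX}` —
# `φ(X) = τ1 − ½τ(e^{iX} + e^{−iX})`: entire, vanishing 1-jet, quadratic part `½τ(X²)` (the printed `½|·|²`), and the identity
# `½(U⁻¹ − 1)(U − 1) = 1 − ½(U + U⁻¹)` behind «½|U − 1|² = 1 − Re tr U»; the `Chart` of `GaugeFixingCubic266` INSTANTIATED for it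
# (cell topic `Summits/QuantumFields/BalabanUV/Beta/GaugeFixingPotential254`; companion of `GaugeFixingCubic266`, same unit)

HONEST FRAMING (cell rule).  Discharging `BetaPertH` makes Bałaban's UV stability UNCONDITIONAL — a real constructive-QFT result;
NOT the continuum limit, NOT the Clay problem.  This module discharges NOTHING of `BetaPertH`: it removes ONE dictionary item of the
companion module `GaugeFixingCubic266` ([I] (2.5) p. 266, the `G₃`-clause of GAPS G-adv9-20 column (a), terminal leaf (T4)(a) of row D4):
there the potential `φ` was abstract («analytic near 0, φ(0) = 0, Dφ(0) = 0, quadratic part = the printed ½|·|²»); here it is THE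
printed one, in Banach-algebra form.  Bookkeeping-grade [folklore] calculus; NOT summit progress.  Unit `b2b-balaban-beta-an4-g32`.

CITATION HEADER (lean-in-tree rule).  [I] = T. Bałaban, *Renormalization group approach to lattice gauge field theories. I.*, Commun.
Math. Phys. **109**, 249–301 (1987) [Balaban1987RG1] (PDF page = journal page − 248), read as images by this seat (renders
`HOME/b2b-balaban-ref1/pages/1987-cmp109-rg-I-small-field/…-p006-x2.png`, `…-p007-x2.png`, `…-p018-x2.png`), verbatim:
p. 254 (0.14) *«Instead we introduce exponential gauge fixing functions, exp[−(1/2α)|U(y,x) − 1|²] = exp[−(1/α)[1 − Re tr U(y,x)]].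
(0.14)»*; p. 255 (0.19), the gauge-fixing term of the k-th step *«−(1/g_k²) Σ_{y∈T^{(k+1)}} Σ_{x∈B(y),x≠y} [1 − Re tr U(y,x)]»*;
p. 266 *«Ṽ′(y,x) = … = 1 + B̃′(y,x) + …, where B̃′(y,x) is a linear function, hence the gauge fixing expression has the representation
G(B′) = Σ Σ ½|B̃′(y,x)|² + G₃(B′) = ½G⁽²⁾(B′) + G₃(B′). (2.5)»*.  The complexified real part `Re U := ½(U + U⁻¹)` of a unit and the
per-plaquette Wilson functional `wil τ W = τ1 − τ(Re W)` are the tree's `B9Eq37Insertion.reC` / `wil` ([Balaban1985BackgroundPropagators]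
p. 391, used BY NAME); `‖e^a‖ ≤ e^{‖a‖}` is the tree's `QuantumLattice.norm_exp_le` (module `LieTrotter`, BY NAME).

WHAT THIS FILE PROVES ([folklore]; `𝔄` a complete normed ℂ-algebra, `τ : 𝔄 →L[ℂ] ℂ` any continuous linear functional — the
normalised trace in print):
* §1 `gfPot τ X := τ1 − ½τ(exp(iX) + exp(−iX))` — the potential `1 − Re tr e^{iX}` with `Re` complexified (holomorphic in `X ∈ 𝔤^c`,
  which is what [I] §3 needs); `gfPot_zero`; THE IDENTITY OF (0.14): `wil_eq_half_conj` — for EVERY unit `W`,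
  `wil τ W = ½τ((W⁻¹ − 1)(W − 1))` (on the unitary group `W⁻¹ = W*`, so this is `½|W − 1|²` for the trace form), and
  `gfPot_eq_wil` — `gfPot τ X = wil τ (e^{iX})` (so the (0.19) summand IS this potential in the chart);
* §2 `analyticOnNhd_gfPot` (entire), `norm_gfPot_le` (`‖gfPot τ X‖ ≤ ‖τ‖(1 + e^{‖X‖})`, `‖1‖ = 1`);
* §3 THE JET AT `0` along complex lines (`hasDerivAt_exp_smul_const`): `hasDerivAt_slice_gfPot`, `fderiv_gfPot_zero : fderiv ℂ (gfPot τ) 0 = 0`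
  (the linear term of `1 − Re tr e^{iX}` vanishes — the reason (2.5) starts at `½|B̃′|²`), and
  **`homPart_gfPot_two : homPart (gfPot τ) 2 X = ½τ(X·X)`** — the printed `½|B̃′(y,x)|²` IS the quadratic part of the potential at
  the linear part of the block variable (`|X|² = τ(X²)` for the trace form on Hermitian `X`);
* §4 **`chart_gfPot`**: for block variables `X_i` analytic and bounded by `MX < Rφ` on a ball with `X_i(0) = 0`, the hypothesis bundle
  `GaugeFixingCubic266.Chart (gfPot τ) X Rφ (‖τ‖(1 + e^{Rφ})) RX MX` HOLDS — hence every conclusion of the companion module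
  (`BeginsAt G₃ 3`, the cubic bound, `homPart G 2 = ΣΣ ½τ(B̃′²)`, `G₃ = rem G 2`, blockwise localisation, the T4 edge) for the printed
  potential: `gaugeFixing_cubic`.

NOT CLAIMED (dictionary, as in the companion): that Bałaban's `Ṽ′(y,x)(B′)` has a Lie-algebra coordinate analytic on a k- and volume-uniform
polydisc (B7-level, by reference in print); the normalisation `τ1 = 1` («tr» normalised) and the Hermitian/anti-Hermitian convention for
𝔤 (only the bilinear form `τ(X²)` is typed); polydiscs vs balls.  No `def … : Prop`; nothing about Bałaban's `β`-functions is asserted.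
PRIOR ART (searched 2026-08-20; nothing re-derived): `B9Eq37Insertion` (`reC`, `wil`, `wil_eq_one_sub_re` on the group), `B13HaarSigma`
(the Haar density `σ` in the same exponential chart — a different function), `Beta.GaugeTermBackground` (the background dependence of the
QUADRATIC part `½G⁽²⁾`, toy block), `QuantumLattice.norm_exp_le`, `B13ExpansionOrder.leadCoeff_two_eq` — BY NAME.
-/

open Metric Set Filter Topology
open Complex (I)
open NormedSpace (exp)
open Literature.MathematicalPhysics.QuantumFieldTheory.Balaban1983to89
open B13ExpansionOrder (slice BeginsAt homPart rem)
open B9Eq37Insertion (reC wil)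
open Summit.QuantumFields.BalabanUV.Beta.GaugeFixingCubic266

namespace Summit.QuantumFields.BalabanUV.Beta.GaugeFixingPotential254

noncomputable section

variable {𝔄 : Type*} [NormedRing 𝔄] [NormedAlgebra ℂ 𝔄]

/-! ## §1. The potential `1 − Re tr e^{iX}` and the identity (0.14) -/

/-- The exponential gauge-fixing potential in the chart `U = e^{iX}`: `τ1 − ½τ(e^{iX} + e^{−iX})` = «1 − Re tr U» with the real part
complexified as `½(U + U⁻¹)`. [cite: Balaban1987RG1, (0.14) p.254] -/
def gfPot (τ : 𝔄 →L[ℂ] ℂ) (X : 𝔄) : ℂ := τ 1 - (2 : ℂ)⁻¹ * τ (exp (I • X) + exp (-(I • X)))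

variable (τ : 𝔄 →L[ℂ] ℂ)

/-- `φ(0) = 0` (`G(V^{(k)}) = 0` ⇒ `G̃(1) = 0`). [folklore] -/
theorem gfPot_zero : gfPot τ 0 = 0 := by
  rw [gfPot, smul_zero, neg_zero, NormedSpace.exp_zero, ← two_smul ℂ (1 : 𝔄), map_smul, smul_eq_mul, ← mul_assoc,
    inv_mul_cancel₀ two_ne_zero, one_mul, sub_self]

/-- **(0.14) as algebra**: for every unit `W`, `1 − Re W = ½(W⁻¹ − 1)(W − 1)` under `τ` — i.e. `wil τ W = ½τ((W⁻¹ − 1)(W − 1))`;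
on the group `W⁻¹ = W*` and the right side is `½|W − 1|²` for the trace form: «exp[−(1/2α)|U − 1|²] = exp[−(1/α)[1 − Re tr U]]».
[cite: Balaban1987RG1, (0.14) p.254] -/
theorem wil_eq_half_conj (τ' : 𝔄 →ₗ[ℂ] ℂ) (W : 𝔄ˣ) :
    wil τ' W = (2 : ℂ)⁻¹ * τ' ((((W⁻¹ : 𝔄ˣ) : 𝔄) - 1) * ((W : 𝔄) - 1)) := by
  have hmul : (((W⁻¹ : 𝔄ˣ) : 𝔄) - 1) * ((W : 𝔄) - 1) = (2 : ℂ) • (1 : 𝔄) - ((W : 𝔄) + ((W⁻¹ : 𝔄ˣ) : 𝔄)) := by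
    rw [sub_mul, mul_sub, mul_sub, Units.inv_mul, one_mul, mul_one, one_mul, two_smul]
    abel
  rw [wil, reC, hmul, map_sub, map_smul, map_smul, smul_eq_mul, smul_eq_mul]
  ring

variable [CompleteSpace 𝔄]

/-- The unit `e^{Z}` with inverse `e^{−Z}`. [folklore] -/
def expUnit (Z : 𝔄) : 𝔄ˣ :=
  letI : NormedAlgebra ℚ 𝔄 := NormedAlgebra.restrictScalars ℚ ℂ 𝔄
  ⟨exp Z, exp (-Z),
    by rw [← NormedSpace.exp_add_of_commute (Commute.neg_right (Commute.refl Z)), add_neg_cancel, NormedSpace.exp_zero],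
    by rw [← NormedSpace.exp_add_of_commute (Commute.neg_left (Commute.refl Z)), neg_add_cancel, NormedSpace.exp_zero]⟩

/-- `↑(expUnit Z) = e^{Z}`. [folklore] -/
@[simp] theorem coe_expUnit (Z : 𝔄) : ((expUnit Z : 𝔄ˣ) : 𝔄) = exp Z := rfl

/-- `↑(expUnit Z)⁻¹ = e^{−Z}`. [folklore] -/
@[simp] theorem coe_expUnit_inv (Z : 𝔄) : (((expUnit Z)⁻¹ : 𝔄ˣ) : 𝔄) = exp (-Z) := rfl

/-- **The (0.19) summand IS this potential in the chart**: `gfPot τ X = wil τ (e^{iX})` (`wil τ W = τ1 − τ(Re W)`, `Re W = ½(W + W⁻¹)`,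
`B9Eq37Insertion`). [cite: Balaban1987RG1, (0.19) p.255] -/
theorem gfPot_eq_wil (X : 𝔄) : gfPot τ X = wil (τ : 𝔄 →ₗ[ℂ] ℂ) (expUnit (I • X)) := by
  rw [wil, reC, coe_expUnit, coe_expUnit_inv, map_smul, smul_eq_mul, gfPot]
  rfl

/-- Hence, with (0.14): `gfPot τ X = ½τ((e^{−iX} − 1)(e^{iX} − 1))` — «½|Ṽ′ − 1|²» in the chart. [cite: Balaban1987RG1, (0.14) p.254] -/
theorem gfPot_eq_half_conj (X : 𝔄) : gfPot τ X = (2 : ℂ)⁻¹ * τ ((exp (-(I • X)) - 1) * (exp (I • X) - 1)) := by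
  rw [gfPot_eq_wil, wil_eq_half_conj, coe_expUnit, coe_expUnit_inv]
  rfl

/-! ## §2. Analyticity and a sup bound -/

/-- `X ↦ e^{iX}` and `X ↦ e^{−iX}` are entire. [folklore] -/
theorem analyticAt_exp_I_smul (X₀ : 𝔄) : AnalyticAt ℂ (fun X : 𝔄 => exp (I • X)) X₀ := by
  have hL : AnalyticAt ℂ (fun X : 𝔄 => I • X) X₀ := (I • ContinuousLinearMap.id ℂ 𝔄).analyticAt X₀
  exact (NormedSpace.exp_analytic (𝕂 := ℂ) (I • X₀)).comp hL

/-- `X ↦ e^{−iX}` is entire. [folklore] -/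
theorem analyticAt_exp_neg_I_smul (X₀ : 𝔄) : AnalyticAt ℂ (fun X : 𝔄 => exp (-(I • X))) X₀ := by
  have hL : AnalyticAt ℂ (fun X : 𝔄 => -(I • X)) X₀ := (-(I • ContinuousLinearMap.id ℂ 𝔄)).analyticAt X₀
  exact (NormedSpace.exp_analytic (𝕂 := ℂ) (-(I • X₀))).comp_of_eq hL rfl

/-- The potential is entire. [folklore] -/
theorem analyticOnNhd_gfPot (s : Set 𝔄) : AnalyticOnNhd ℂ (gfPot τ) s := fun X₀ _ =>
  analyticAt_const.sub (analyticAt_const.mul ((τ.analyticAt _).comp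
    ((analyticAt_exp_I_smul X₀).add (analyticAt_exp_neg_I_smul X₀))))

/-- A sup bound: `‖φ(X)‖ ≤ ‖τ‖(1 + e^{‖X‖})` (`‖e^a‖ ≤ e^{‖a‖}` in a Banach algebra with `‖1‖ = 1`, `LieTrotter.norm_exp_le`). [folklore] -/
theorem norm_gfPot_le [NormOneClass 𝔄] (X : 𝔄) : ‖gfPot τ X‖ ≤ ‖τ‖ * (1 + Real.exp ‖X‖) := by
  have hI : ‖I • X‖ = ‖X‖ := by rw [norm_smul, Complex.norm_I, one_mul]
  have h1 : ‖τ 1‖ ≤ ‖τ‖ := by simpa using τ.le_opNorm (1 : 𝔄)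
  have h2 : ‖exp (I • X)‖ ≤ Real.exp ‖X‖ := by
    simpa [hI] using Literature.MathematicalPhysics.QuantumLattice.norm_exp_le ℂ (I • X)
  have h3 : ‖exp (-(I • X))‖ ≤ Real.exp ‖X‖ := by
    simpa [norm_neg, hI] using Literature.MathematicalPhysics.QuantumLattice.norm_exp_le ℂ (-(I • X))
  have h4 : ‖(2 : ℂ)⁻¹ * τ (exp (I • X) + exp (-(I • X)))‖ ≤ ‖τ‖ * Real.exp ‖X‖ := by
    rw [norm_mul, norm_inv, Complex.norm_ofNat]
    have hτ := τ.le_opNorm (exp (I • X) + exp (-(I • X)))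
    have hs : ‖exp (I • X) + exp (-(I • X))‖ ≤ 2 * Real.exp ‖X‖ := (norm_add_le _ _).trans (by linarith)
    nlinarith [norm_nonneg τ, mul_le_mul_of_nonneg_left hs (norm_nonneg τ)]
  calc ‖gfPot τ X‖ ≤ ‖τ 1‖ + ‖(2 : ℂ)⁻¹ * τ (exp (I • X) + exp (-(I • X)))‖ := norm_sub_le _ _
    _ ≤ ‖τ‖ + ‖τ‖ * Real.exp ‖X‖ := add_le_add h1 h4
    _ = ‖τ‖ * (1 + Real.exp ‖X‖) := by ring

/-! ## §3. The jet at `0`: no linear term, quadratic part `½τ(X²)` -/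

/-- The slice derivative: `d/dt φ(tX) = −½τ(e^{itX}·iX + e^{−itX}·(−iX))`. [folklore] -/
theorem hasDerivAt_slice_gfPot (X : 𝔄) (t : ℂ) :
    HasDerivAt (slice (gfPot τ) X)
      (-((2 : ℂ)⁻¹ * τ (exp (t • (I • X)) * (I • X) + exp (t • -(I • X)) * -(I • X)))) t := by
  have hF : HasDerivAt (fun s : ℂ => exp (s • (I • X)) + exp (s • -(I • X)))
      (exp (t • (I • X)) * (I • X) + exp (t • -(I • X)) * -(I • X)) t :=
    (hasDerivAt_exp_smul_const (I • X) t).add (hasDerivAt_exp_smul_const (-(I • X)) t)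
  have hτF := ((τ : 𝔄 →L[ℂ] ℂ).hasFDerivAt.comp_hasDerivAt t hF).const_mul (2 : ℂ)⁻¹
  have h := hτF.const_sub (τ 1)
  have hfun : slice (gfPot τ) X = fun s : ℂ => τ 1 - (2 : ℂ)⁻¹ * τ (exp (s • (I • X)) + exp (s • -(I • X))) := by
    funext s
    simp only [slice, gfPot, smul_comm I s X, smul_neg]
  rw [hfun]
  exact h

/-- The second slice derivative at `0`: `(d/dt)² φ(tX)|₀ = τ(X²)`. [folklore] -/
theorem deriv_deriv_slice_gfPot (X : 𝔄) : deriv (deriv (slice (gfPot τ) X)) 0 = τ (X * X) := by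
  have hd : deriv (slice (gfPot τ) X) =
      fun t => -((2 : ℂ)⁻¹ * τ (exp (t • (I • X)) * (I • X) + exp (t • -(I • X)) * -(I • X))) :=
    funext fun t => (hasDerivAt_slice_gfPot τ X t).deriv
  have hG : HasDerivAt (fun s : ℂ => exp (s • (I • X)) * (I • X) + exp (s • -(I • X)) * -(I • X))
      (exp ((0 : ℂ) • (I • X)) * (I • X) * (I • X) + exp ((0 : ℂ) • -(I • X)) * -(I • X) * -(I • X)) 0 :=
    ((hasDerivAt_exp_smul_const (I • X) 0).mul_const _).add ((hasDerivAt_exp_smul_const (-(I • X)) 0).mul_const _)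
  have h2 : HasDerivAt (deriv (slice (gfPot τ) X))
      (-((2 : ℂ)⁻¹ * τ (exp ((0 : ℂ) • (I • X)) * (I • X) * (I • X) + exp ((0 : ℂ) • -(I • X)) * -(I • X) * -(I • X)))) 0 := by
    rw [hd]
    exact (((τ : 𝔄 →L[ℂ] ℂ).hasFDerivAt.comp_hasDerivAt 0 hG).const_mul (2 : ℂ)⁻¹).neg
  have hsq : (I • X) * (I • X) = -(X * X) := by
    rw [smul_mul_smul_comm, Complex.I_mul_I, neg_smul, one_smul]
  have hG0 : exp ((0 : ℂ) • (I • X)) * (I • X) * (I • X) + exp ((0 : ℂ) • -(I • X)) * -(I • X) * -(I • X) =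
      -((2 : ℂ) • (X * X)) := by
    rw [zero_smul, zero_smul, NormedSpace.exp_zero, one_mul, one_mul, neg_mul_neg, hsq, two_smul]
    abel
  rw [h2.deriv, hG0, map_neg, map_smul, smul_eq_mul]
  ring

/-- **No linear term**: `Dφ(0) = 0` — every slice derivative at `0` is `−½τ(iX − iX) = 0`. [cite: Balaban1987RG1, (2.5) p.266] -/
theorem fderiv_gfPot_zero : fderiv ℂ (gfPot τ) (0 : 𝔄) = 0 := by
  ext X
  have hdiff : DifferentiableAt ℂ (gfPot τ) 0 := (analyticOnNhd_gfPot τ univ 0 (mem_univ _)).differentiableAt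
  rw [show (0 : 𝔄 →L[ℂ] ℂ) X = 0 from rfl, ← B13ExpansionOrder.deriv_slice_zero hdiff X, (hasDerivAt_slice_gfPot τ X 0).deriv]
  simp

/-- **The quadratic part is `½τ(X²)`** — the printed `½|B̃′(y,x)|²` with `|X|² = τ(X²)`: `homPart (gfPot τ) 2 X = ½τ(X·X)`
(`homPart f 2 w = ½(d/dt)²f(tw)|₀`, `B13ExpansionOrder.leadCoeff_two_eq`). [cite: Balaban1987RG1, (2.5) p.266] -/
theorem homPart_gfPot_two (X : 𝔄) : homPart (gfPot τ) 2 X = (2 : ℂ)⁻¹ * τ (X * X) := by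
  have hd : DifferentiableOn ℂ (slice (gfPot τ) X) (ball 0 1) := fun t _ =>
    (hasDerivAt_slice_gfPot τ X t).differentiableAt.differentiableWithinAt
  rw [homPart, B13ExpansionOrder.leadCoeff_two_eq one_pos hd, deriv_deriv_slice_gfPot, smul_eq_mul]

/-! ## §4. The `Chart` of the companion module, instantiated -/

variable {E : Type*} [NormedAddCommGroup E] [NormedSpace ℂ E] {ι : Type*}

/-- **The printed potential satisfies the abstract hypotheses**: with block variables `X_i` analytic and bounded by `MX < Rφ` on
`ball 0 RX`, `X_i(0) = 0`, the bundle `Chart (gfPot τ) X Rφ (‖τ‖(1 + e^{Rφ})) RX MX` holds. [folklore] -/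
theorem chart_gfPot [NormOneClass 𝔄] {X : ι → E → 𝔄} {Rφ RX MX : ℝ} (hRφ : 0 < Rφ) (hRX : 0 < RX)
    (hXan : ∀ i, AnalyticOnNhd ℂ (X i) (ball 0 RX)) (hXbd : ∀ i, ∀ B ∈ ball (0 : E) RX, ‖X i B‖ ≤ MX)
    (hX0 : ∀ i, X i 0 = 0) (hMX : MX < Rφ) :
    Chart (gfPot τ) X Rφ (‖τ‖ * (1 + Real.exp Rφ)) RX MX where
  Rφ_pos := hRφ
  RX_pos := hRX
  φ_an := analyticOnNhd_gfPot τ _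
  φ_bd v hv := (norm_gfPot_le τ v).trans
    (mul_le_mul_of_nonneg_left (by linarith [Real.exp_le_exp.2 (mem_ball_zero_iff.1 hv).le]) (norm_nonneg τ))
  φ_zero := gfPot_zero τ
  φ_crit := fderiv_gfPot_zero τ
  X_an := hXan
  X_bd := hXbd
  X_zero := hX0
  MX_lt := hMX

/-- **(2.5) for the printed potential**: `G₃ := ΣΣ[1 − Re tr e^{iX_{yx}(B′)}] − ΣΣ ½τ(B̃′(y,x)²)` is analytic on the ball, begins with
third order terms (`BeginsAt … 3`), obeys the explicit cubic bound, and is the remainder of `G` after its quadratic part — all by the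
companion module's theorems with `Chart` discharged by `chart_gfPot`. [cite: Balaban1987RG1, (2.5) p.266] -/
theorem gaugeFixing_cubic [NormOneClass 𝔄] [Fintype ι] {X : ι → E → 𝔄} {Rφ RX MX : ℝ} (hRφ : 0 < Rφ) (hRX : 0 < RX)
    (hXan : ∀ i, AnalyticOnNhd ℂ (X i) (ball 0 RX)) (hXbd : ∀ i, ∀ B ∈ ball (0 : E) RX, ‖X i B‖ ≤ MX)
    (hX0 : ∀ i, X i 0 = 0) (hMX : MX < Rφ) :
    AnalyticOnNhd ℂ (gCubic (gfPot τ) X) (ball 0 RX) ∧ BeginsAt (gCubic (gfPot τ) X) 3 ∧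
      (∀ B ∈ ball (0 : E) RX, ‖gCubic (gfPot τ) X B‖ ≤ cubicConst Rφ (‖τ‖ * (1 + Real.exp Rφ)) RX MX (Fintype.card ι) * ‖B‖ ^ 3) ∧
      gCubic (gfPot τ) X = rem (gTot (gfPot τ) X) 2 ∧
      (∀ B, gQuad (gfPot τ) X B = ∑ i, (2 : ℂ)⁻¹ * τ (linPart X i B * linPart X i B)) := by
  have h := chart_gfPot τ hRφ hRX hXan hXbd hX0 hMX
  refine ⟨h.analyticOnNhd_gCubic, h.beginsAt_gCubic_three, fun B hB => h.norm_gCubic_le hB, h.gCubic_eq_rem, fun B => ?_⟩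
  simp only [gQuad, homPart_gfPot_two]

end

end Summit.QuantumFields.BalabanUV.Beta.GaugeFixingPotential254
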